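import Summits.HubbardSuperconductivity.HubbardSuperconductivity.Theorems.LevyLogBootstrapLevyTransportCrudeFloorPeriodic
import Summits.HubbardSuperconductivity.HubbardSuperconductivity.Theorems.LevyLogBootstrapBlock2InfDivXXZAutSymmetry
import Literature.Probability.LatticeModels.IsingTransport
import Literature.Probability.LatticeModels.GaussianDomination
import HarnessLib

/-!
# Crude floor, part 4: the variational bound `E₀ ≤ -|E|/4`, torus walks and translations

Crux `LevyTransport` (stmt-HubbardSuperconductivity-15049, route `LevyLogBootstrap`), input (c) of
the load-bearing stub `stub_logBootstrap` (`Cruxes/LevyTransport/Lines/birth.lean`): the M-UNIFORM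
ANCHOR of the Lévy mass at the KLS point `Δ = 0`. The anchor is proved WITHOUT reflection positivity
from long-range order + the `T = 0` infrared bound + a crude Perron–Frobenius floor; this file is one
link of that chain (files `…LevyTransportCrudeFloorHops`, `…RowSums`, `…Periodic`, `…Variational`,
`…CrudeFloor`, `…AnchorBlocks`, `…AnchorXY`). Model: `H_G(Δ) = xxzHamiltonian 1 G (-1) Δ`
(hard-core bosons; spin ½, label `0` = up = particle), on the torus `G = torusGraph 2 M`.
Sources: H. Tasaki, *Physics and Mathematics of Quantum Many-Body Systems* (2020) §2.4;
E. Lieb, D. Mattis, J. Math. Phys. 3 (1962) 749; T. Kennedy, E. H. Lieb, B. S. Shastry,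
Phys. Rev. Lett. 61 (1988) 2582. No definition is introduced; sorry-free.

This file: `Σ_σ S(σ) = 0` by a spin-flip involution (`sum_isingSum_eq_zero`), the fully polarised
state bound `groundEnergy_le_neg_card_div_four` (registered torus form
`crudeFloor_groundEnergy_le_torus`), walks of length `≤ 2M` on the `M × M` torus
(`exists_walk_length_le`), translation invariance of configuration probabilities in a sector ground
state (`sectorGS_prob_translate`, from `sectorGS_expect_autInvariant`) and a union bound.
-/

noncomputable section

set_option linter.dupNamespace false

namespace Summit.HubbardSuperconductivity.HubbardSuperconductivity.Theorems.LevyLogBootstrap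

open scoped BigOperators Matrix ComplexOrder
open Matrix Finset Complex
open Literature.MathematicalPhysics.QuantumLattice Literature.Probability.LatticeModels
open Literature.MathematicalPhysics.QuantumLattice.LiebMattis
open Summit.AtomisticToContinuum.BoseEinsteinCondensation.Theorems.BECStronglyRayleighSectorPerron
open Summit.HubbardSuperconductivity.HubbardSuperconductivity.Theorems.PolyaSchurPairBoson

namespace CrudeFloor

variable {Λ : Type*} [Fintype Λ] [DecidableEq Λ]

/-! ### The variational upper bound `E₀ ≤ -|E(G)|/4` (fully polarised product state) -/

section Variational

variable (G : SimpleGraph Λ) [DecidableRel G.Adj] (Δ : ℝ)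

omit [DecidableEq Λ] in
/-- `Σ_σ S(σ) = 0`: flipping the spin at one end of an edge is a sign-reversing involution of the
configurations. [folklore] -/
theorem sum_isingSum_eq_zero [DecidableEq Λ] :
    ∑ σ : TensorIndex Λ 2, (∑ e ∈ G.edgeFinset, Sym2.lift ⟨fun x y => ((1 : ℝ) / 2 - (σ x : ℕ)) * ((1 : ℝ) / 2 - (σ y : ℕ)), fun _ _ => mul_comm _ _⟩ e) = 0 := by
  rw [Finset.sum_comm]
  · refine Finset.sum_eq_zero fun e he => ?_
    induction e using Sym2.ind with
    | h x y =>
      have hxy : x ≠ y := by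
        rw [SimpleGraph.mem_edgeFinset, SimpleGraph.mem_edgeSet] at he
        exact he.ne
      simp only [Sym2.lift_mk]
      -- the involution flipping `σ x`
      set F : TensorIndex Λ 2 → TensorIndex Λ 2 := fun σ => Function.update σ x ((σ x).rev) with hF
      have hFinv : Function.Involutive F := fun σ => by
        simp only [hF]
        rw [Function.update_self, Function.update_idem, Fin.rev_rev, Function.update_eq_self]
      set e : TensorIndex Λ 2 ≃ TensorIndex Λ 2 := hFinv.toPerm F with he'
      have hsum := Equiv.sum_comp e (fun σ : TensorIndex Λ 2 =>
        ((1 : ℝ) / 2 - (σ x : ℕ)) * ((1 : ℝ) / 2 - (σ y : ℕ)))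
      have hterm : ∀ σ : TensorIndex Λ 2, ((1 : ℝ) / 2 - ((e σ) x : ℕ)) * ((1 : ℝ) / 2 - ((e σ) y : ℕ)) =
          -(((1 : ℝ) / 2 - (σ x : ℕ)) * ((1 : ℝ) / 2 - (σ y : ℕ))) := by
        intro σ
        have hex : (e σ) x = (σ x).rev := by
          simp only [he', Function.Involutive.coe_toPerm, hF, Function.update_self]
        have hey : (e σ) y = σ y := by
          simp only [he', Function.Involutive.coe_toPerm, hF, Function.update_of_ne hxy.symm]
        rw [hex, hey]
        rcases fin_two_eq_zero_or_one (σ x) with h | h <;> simp [h] <;> ring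
      simp_rw [hterm, Finset.sum_neg_distrib] at hsum
      linarith

/-- **The fully polarised state has energy `-|E(G)|/4`, so `E₀(H_G(Δ)) ≤ -|E(G)|/4`** for every
real `Δ` (variational principle with the normalised all-ones vector). [folklore] -/
theorem groundEnergy_le_neg_card_div_four [Nonempty Λ] :
    (xxzHamiltonian 1 G (-1) Δ : Op Λ 2).groundEnergy ≤ -(G.edgeFinset.card : ℝ) / 4 := by
  obtain ⟨-, hreal, -, -⟩ := ham_entries G Δ
  have hrow0 := sum_re_ham_row G Δ
  set H : Op Λ 2 := xxzHamiltonian 1 G (-1) Δ with hHdef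
  have hH : H.IsHermitian := xxzHamiltonian_isHermitian 1 G (-1) Δ
  set D : ℕ := Fintype.card (TensorIndex Λ 2) with hD
  have hD0 : (0 : ℝ) < D := by rw [hD]; exact_mod_cast Fintype.card_pos
  set sD : ℝ := Real.sqrt D with hsD
  have hss : sD * sD = D := Real.mul_self_sqrt hD0.le
  have hs0 : sD ≠ 0 := by rw [hsD]; exact Real.sqrt_ne_zero'.2 hD0
  set u : TensorIndex Λ 2 → ℂ := fun _ => ((sD⁻¹ : ℝ) : ℂ) with hu
  have hcc : ((D : ℝ)) * (sD⁻¹ * sD⁻¹) = 1 := by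
    rw [← mul_inv, hss, mul_inv_cancel₀ hD0.ne']
  have hunit : star u ⬝ᵥ u = 1 := by
    rw [dotProduct]
    simp only [hu, Pi.star_apply, Complex.star_def, Complex.conj_ofReal, Finset.sum_const,
      Finset.card_univ, nsmul_eq_mul]
    rw [← hD]
    have : ((D : ℂ)) * ((((sD)⁻¹ : ℝ) : ℂ) * (((sD)⁻¹ : ℝ) : ℂ)) =
        (((D : ℝ) * (sD⁻¹ * sD⁻¹) : ℝ) : ℂ) := by push_cast; ring
    rw [this, hcc]
    simp
  have hray := groundEnergy_le_rayleigh_holds hH u hunit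
  refine hray.trans (le_of_eq ?_)
  -- `⟨u, H u⟩ = D⁻¹ Σ_σ (H 𝟙)(σ) = -|E|/4 + (1-Δ) D⁻¹ Σ_σ S(σ) = -|E|/4`
  have hHu : ∀ σ, (H *ᵥ u) σ = ((((sD)⁻¹ : ℝ) : ℂ)) * (H *ᵥ fun _ => (1 : ℂ)) σ := by
    intro σ
    simp only [mulVec, dotProduct, hu, Finset.mul_sum]
    exact Finset.sum_congr rfl fun τ _ => by ring
  have hrow : ∀ σ, ((H *ᵥ fun _ => (1 : ℂ)) σ).re = -(G.edgeFinset.card : ℝ) / 4 + (1 - Δ) * (∑ e ∈ G.edgeFinset, Sym2.lift ⟨fun x y => ((1 : ℝ) / 2 - (σ x : ℕ)) * ((1 : ℝ) / 2 - (σ y : ℕ)), fun _ _ => mul_comm _ _⟩ e) := by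
    intro σ
    have := hrow0 σ
    rw [mulVec, dotProduct, Complex.re_sum]
    simp only [mul_one]
    exact this
  rw [dotProduct, Complex.re_sum]
  simp only [Pi.star_apply, hHu]
  have hterm : ∀ σ, (star (u σ) * (((((sD)⁻¹ : ℝ) : ℂ)) * (H *ᵥ fun _ => (1 : ℂ)) σ)).re =
      sD⁻¹ * sD⁻¹ * (-(G.edgeFinset.card : ℝ) / 4 + (1 - Δ) * (∑ e ∈ G.edgeFinset, Sym2.lift ⟨fun x y => ((1 : ℝ) / 2 - (σ x : ℕ)) * ((1 : ℝ) / 2 - (σ y : ℕ)), fun _ _ => mul_comm _ _⟩ e)) := by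
    intro σ
    simp only [hu, Complex.star_def, Complex.conj_ofReal]
    rw [← mul_assoc, ← Complex.ofReal_mul, Complex.re_ofReal_mul, hrow]
  rw [Finset.sum_congr rfl fun σ _ => hterm σ, ← Finset.mul_sum, Finset.sum_add_distrib,
    Finset.sum_const, Finset.card_univ, ← hD, nsmul_eq_mul, ← Finset.mul_sum, sum_isingSum_eq_zero G,
    mul_zero, add_zero]
  calc sD⁻¹ * sD⁻¹ * ((D : ℝ) * (-(G.edgeFinset.card : ℝ) / 4))
      = ((D : ℝ) * (sD⁻¹ * sD⁻¹)) * (-(G.edgeFinset.card : ℝ) / 4) := by ring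
    _ = -(G.edgeFinset.card : ℝ) / 4 := by rw [hcc, one_mul]

end Variational

/-! ### The torus: walks, translations, and the floor -/

section Torus

variable (M : ℕ) [NeZero M]

omit [NeZero M] in
/-- A straight walk of length `k` along direction `i`. [folklore] -/
theorem exists_walk_add_nsmul_single (h2 : 2 ≤ M) (z : TorusSite 2 M) (i : Fin 2) :
    ∀ (k : ℕ) (w : TorusSite 2 M), w = z + k • (Pi.single i (1 : ZMod M) : TorusSite 2 M) →
      ∃ p : (torusGraph 2 M).Walk z w, p.length = k := by
  intro k
  induction k with
  | zero =>
    intro w hw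
    rw [zero_smul, add_zero] at hw
    subst hw
    exact ⟨SimpleGraph.Walk.nil, rfl⟩
  | succ k ih =>
    intro w hw
    obtain ⟨p, hp⟩ := ih (z + k • (Pi.single i (1 : ZMod M) : TorusSite 2 M)) rfl
    have hadj : (torusGraph 2 M).Adj (z + k • (Pi.single i (1 : ZMod M) : TorusSite 2 M))
        (z + k • (Pi.single i (1 : ZMod M) : TorusSite 2 M) + Pi.single i 1) :=
      torusGraph_adj_add_single h2 _ i
    have hw' : w = z + k • (Pi.single i (1 : ZMod M) : TorusSite 2 M) + Pi.single i 1 := by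
      rw [hw, succ_nsmul, add_assoc]
    subst hw'
    exact ⟨p.concat hadj, by rw [SimpleGraph.Walk.length_concat, hp]⟩

/-- **Walks of length `≤ 2M` join any two sites of the `M × M` torus** (go along the first axis,
then along the second). [folklore] -/
theorem exists_walk_length_le (h2 : 2 ≤ M) (y x : TorusSite 2 M) :
    ∃ p : (torusGraph 2 M).Walk y x, p.length ≤ 2 * M := by
  set v : TorusSite 2 M := x - y with hv
  set z : TorusSite 2 M := y + (v 0).val • (Pi.single 0 (1 : ZMod M) : TorusSite 2 M) with hz
  obtain ⟨p₀, hp₀⟩ := exists_walk_add_nsmul_single M h2 y 0 (v 0).val z rfl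
  have hx : x = z + (v 1).val • (Pi.single 1 (1 : ZMod M) : TorusSite 2 M) := by
    have hdec : v = (v 0).val • (Pi.single 0 (1 : ZMod M) : TorusSite 2 M) +
        (v 1).val • (Pi.single 1 (1 : ZMod M) : TorusSite 2 M) := by
      have h := (Finset.univ_sum_single v).symm
      rw [Fin.sum_univ_two] at h
      have e0 : (Pi.single 0 (v 0) : TorusSite 2 M) = (v 0).val • (Pi.single 0 (1 : ZMod M) : TorusSite 2 M) := by
        rw [← Pi.single_smul', nsmul_one, ZMod.natCast_zmod_val]
      have e1 : (Pi.single 1 (v 1) : TorusSite 2 M) = (v 1).val • (Pi.single 1 (1 : ZMod M) : TorusSite 2 M) := by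
        rw [← Pi.single_smul', nsmul_one, ZMod.natCast_zmod_val]
      rw [← e0, ← e1]
      exact h
    rw [hz, add_assoc, ← hdec, hv]
    abel
  obtain ⟨p₁, hp₁⟩ := exists_walk_add_nsmul_single M h2 z 1 (v 1).val x hx
  refine ⟨p₀.append p₁, ?_⟩
  rw [SimpleGraph.Walk.length_append, hp₀, hp₁]
  have h0 := (v 0).val_lt
  have h1 := (v 1).val_lt
  omega

/-- **Translation invariance of configuration probabilities in a sector ground state of the
torus**: for any sector ground vector `φ` of `H_M(Δ)` (any real `Δ`, any sector), any property `P`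
of configurations and any translation `a`,
`Σ_{σ : P(σ(· + a))} |φ(σ)|² = Σ_{σ : P σ} |φ(σ)|²` (`sectorGS_expect_autInvariant` with a
diagonal indicator observable). [folklore] -/
theorem sectorGS_prob_translate (Δ m : ℝ) (φ : TensorIndex (TorusSite 2 M) 2 → ℂ)
    (hφ : φ ∈ @spinZSector (TorusSite 2 M) _ _ 1 m)
    (heig : Matrix.mulVec (xxzHamiltonian 1 (torusGraph 2 M) (-1) Δ) φ =
      ((lowestEnergyInSector 1 (xxzHamiltonian 1 (torusGraph 2 M) (-1) Δ) m : ℝ) : ℂ) • φ)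
    (P : TensorIndex (TorusSite 2 M) 2 → Prop) [DecidablePred P] (a : TorusSite 2 M) :
    ∑ σ ∈ Finset.univ.filter (fun σ : TensorIndex (TorusSite 2 M) 2 => P (fun z => σ (z + a))),
        star (φ σ) * φ σ =
      ∑ σ ∈ Finset.univ.filter P, star (φ σ) * φ σ := by
  classical
  set π : TorusSite 2 M ≃ TorusSite 2 M := Equiv.addRight a with hπ
  have hπadj : ∀ x y, (torusGraph 2 M).Adj (π x) (π y) ↔ (torusGraph 2 M).Adj x y :=
    fun x y => torusGraph_adj_add_right a x y
  set d : TensorIndex (TorusSite 2 M) 2 → ℂ := fun σ => if P σ then 1 else 0 with hd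
  have key := sectorGS_expect_autInvariant (TorusSite 2 M) (torusGraph 2 M) (torusGraph_connected 2 M)
    Δ m π hπadj φ hφ heig (diagonal d)
  have hinj : Function.Injective (fun σ : TensorIndex (TorusSite 2 M) 2 => σ ∘ π) := by
    intro σ τ h
    funext z
    have := congrFun h (π.symm z)
    simpa using this
  rw [submatrix_diagonal d _ hinj] at key
  have hquad : ∀ g : TensorIndex (TorusSite 2 M) 2 → ℂ,
      star φ ⬝ᵥ (diagonal g *ᵥ φ) = ∑ σ, g σ * (star (φ σ) * φ σ) := by
    intro g
    rw [dotProduct]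
    refine Finset.sum_congr rfl fun σ _ => ?_
    rw [mulVec_diagonal, Pi.star_apply]
    ring
  rw [hquad, hquad] at key
  rw [Finset.sum_filter, Finset.sum_filter]
  have hl : ∀ σ : TensorIndex (TorusSite 2 M) 2,
      (if P (fun z => σ (z + a)) then star (φ σ) * φ σ else 0) = (d ∘ fun σ => σ ∘ π) σ * (star (φ σ) * φ σ) := by
    intro σ
    simp only [hd, Function.comp_def, hπ, Equiv.coe_addRight]
    split_ifs <;> simp
  have hr : ∀ σ : TensorIndex (TorusSite 2 M) 2,
      (if P σ then star (φ σ) * φ σ else 0) = d σ * (star (φ σ) * φ σ) := by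
    intro σ
    simp only [hd]
    split_ifs <;> simp
  simp_rw [hl, hr]
  exact key

/-- **Registered form (torus)** of `groundEnergy_le_neg_card_div_four`:
`E₀(H_M(Δ)) ≤ -|E(torus)|/4` for every real `Δ`. [folklore] -/
theorem crudeFloor_groundEnergy_le_torus :
    ∀ (M : ℕ) [NeZero M] (Δ : ℝ),
      (xxzHamiltonian 1 (torusGraph 2 M) (-1) Δ : Op (TorusSite 2 M) 2).groundEnergy ≤
        -((torusGraph 2 M).edgeFinset.card : ℝ) / 4 :=
  fun M _ Δ => by
    haveI : Nonempty (TorusSite 2 M) := ⟨fun _ => 0⟩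
    exact groundEnergy_le_neg_card_div_four (torusGraph 2 M) Δ

end Torus

end CrudeFloor

end Summit.HubbardSuperconductivity.HubbardSuperconductivity.Theorems.LevyLogBootstrap

end
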